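import Mathlib
import Summits.ResolutionOfSingularities.ResolutionOfSingularities.Theorems.WeightedInvariantLocalWeightedDropNCResSettingPermissible
import Summits.ResolutionOfSingularities.ResolutionOfSingularities.Theorems.WeightedInvariantLocalWeightedDropTOT2NearOld
import Summits.ResolutionOfSingularities.ResolutionOfSingularities.Theorems.WeightedInvariantLocalWeightedDropUnaryConeForm
import Summits.ResolutionOfSingularities.ResolutionOfSingularities.Theorems.WeightedInvariantLocalWeightedDropWeierstrassForm
import Summits.ResolutionOfSingularities.ResolutionOfSingularities.Theorems.WeightedInvariantLocalWeightedDropAxisNormalize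
import Summits.ResolutionOfSingularities.ResolutionOfSingularities.Theorems.WeightedInvariantLocalWeightedDropNCProductClosure

/-!
# `WeightedInvariant.LocalWeightedDrop`, TOT2-LINE inner assembly, sub-regime «`y ∈ O`»: **ENTRY WITH AN OLD LETTER — the monic presentation by a
# SWAP of letters when the tangent cone is a power of a boundary letter**

Crux item stmt-ResolutionOfSingularities-8899 `LocalWeightedDrop` (route `ResolutionOfSingularities/WeightedInvariant`), ENGINE skeleton v32
(ddb48572591139d5), registered stub `stub_spaceNCRankDrop`; TOT2-LINE v1.2 (G1) entry, QUESTION Q6 of res-L1-w43-lead-1 (sub-regime `y ∈ O`: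
the old component is the maximal-contact plane and must stay a STRAIGHT letter of the presentation — so the entry may not use the general linear
change `M` of `WeierstrassForm.exists_monicForm` / `UnaryConeForm.exists_normalForm`, only a PERMUTATION of the letters).  [OURS · L1 W4.3 · chain
w43 · stub worker res-L1-w43-stub-2 (gen 5), on res-type-083's Weierstrass files (`WeierstrassForm.exists_monic_of_polyhedronCond`,
`UnaryConeForm.coeff_of_initEval_eq`), res-L1-w43-stub-3's `TOT2NearOld.initForm_mul_X`, `AxisNormalize.initEval_subst_linSubst`,
`NCTransport.isUnit_det_linMat_perm`, res-L1-w43-stub-1's S-SET.  Nothing here is a statement of any manuscript; AI-produced, gate-checked,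
weaker than expert review.  Definition-free.]

* `linSubst_permMatrix_apply`, `initEval_subst_X_perm` — a permutation of the letters `x_i ↦ x_{π i}` is the linear substitution by the permutation
  matrix, and `in_d (f ∘ π)(v) = in_d f (v ∘ π)`;
* `isCountMove_X_perm`, `isBPermissible_point_X_perm` — it is a legal move straightening EVERY letter (B-permissible for the point centre, any `δ`);
* `initEval_eq_of_initEval_mul_X` — **cone division**: `in_{o+1}(f · x_l)(v) = λ · v_l^{o+1}` for all `v` ⇒ `in_o(f)(v) = λ · v_l^o` (polynomial
  identity over an infinite field, `initForm_mul_X`, cancellation of `x_l`);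
* **`exists_monicForm_subst_swap_of_cone`** — if `ord f ≥ d` and `in_d f = λ · x_l^d` (`λ ≠ 0`) then after the SWAP `x_l ↔ y`:
  `f ∘ swap = H · (y^d + Σ_{j<d} A_j y^j)` with `H(0) ≠ 0`, `ord A_j > d − j` (`exists_monic_of_polyhedronCond`; no Tschirnhaus, no mixing);
* `monicForm_mul_X_last`, `isPos_vecCons_zero` — `(y^d + Σ A_j y^j) · y` is the monic form of the label `(0, A_0, …, A_{d−1})` (slot `0` ZERO), a position;
* **`exists_presentation_swap_of_oldLetter_cone`** — THE DECORATED ENTRY: `O = {l}` and `in_{o+1}(f · x_l) = λ · x_l^{o+1}` ⇒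
  `(f · ∏_{O} x_l) ∘ swap = H · monicForm A` with `A : Fin (o+1) → k⟦u⟧`, `A 0 = 0`, `A` a position — the input of
  `PolyDescent.wellPrepared_of_apply_zero_eq_zero` / `mem_succTWP_iff_of_apply_zero_eq_zero` (…PolyDescentSelDefs: the lazy strategy never re-centres it);
* `apply_eq_zero_of_cone_mul_X`, `letterCone_of_cone_mul_X`, **`exists_presentation_swap_of_oldLetter_linearCone`** — the same from the `e = 2`
  DETECTION DATA `in_c(f̃)(v) = λ · (ℓ · v)^c` (`WildPurePower.cone_eq_of_wide` on two independent invariance vectors): a linear-form cone of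
  `f · x_l` is automatically along `x_l`;
* `apply_eq_zero_of_cone_mul_prod_X`, `card_le_one_of_cone_mul_prod_X`, **`Decoration.O_eq_empty_or_singleton_of_linearCone`** — THE DISPATCH at the
  entry of the regime: a non-zero linear-form cone of `f · ∏_{l∈O} x_l` forces `O = ∅` (linear entry) or `O = {l}` (swap entry).
-/

set_option linter.dupNamespace false -- mandated namespace of this single-conjunct summit

noncomputable section

namespace Summit.ResolutionOfSingularities.ResolutionOfSingularities.Theorems

namespace TameFourTupleDrop

open MvPowerSeries Literature.AlgebraicGeometry.Resolution

variable {k : Type} [Field k] {m : ℕ}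

/-! ## Permutations of the letters -/

/-- The linear substitution by a permutation matrix is the permutation of the letters. -/
theorem linSubst_permMatrix_apply {N : ℕ} (π : Equiv.Perm (Fin N)) (i : Fin N) :
    FormalCoordChange.linSubst (π.permMatrix k) i = (X (π i) : MvPowerSeries (Fin N) k) := by
  classical
  unfold FormalCoordChange.linSubst
  rw [Finset.sum_eq_single (π i)]
  · rw [Equiv.Perm.permMatrix, PEquiv.toMatrix_toPEquiv_apply, Pi.single_eq_same, one_smul]
  · intro j _ hj
    rw [Equiv.Perm.permMatrix, PEquiv.toMatrix_toPEquiv_apply, Pi.single_eq_of_ne' (Ne.symm hj), zero_smul]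
  · intro h; exact absurd (Finset.mem_univ _) h

/-- `(P_π v)_i = v_{π i}` for the permutation matrix. -/
theorem permMatrix_mulVec_apply {N : ℕ} (π : Equiv.Perm (Fin N)) (v : Fin N → k) (i : Fin N) :
    (π.permMatrix k).mulVec v i = v (π i) := by
  classical
  rw [Matrix.mulVec, dotProduct, Finset.sum_eq_single (π i)]
  · rw [Equiv.Perm.permMatrix, PEquiv.toMatrix_toPEquiv_apply, Pi.single_eq_same, one_mul]
  · intro j _ hj
    rw [Equiv.Perm.permMatrix, PEquiv.toMatrix_toPEquiv_apply, Pi.single_eq_of_ne' (Ne.symm hj), zero_mul]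
  · intro h; exact absurd (Finset.mem_univ _) h

/-- **`in_d (f ∘ π)(v) = in_d f (v ∘ π)`** for a permutation of the letters (`N ≥ 1`). -/
theorem initEval_subst_X_perm {N : ℕ} (π : Equiv.Perm (Fin (N + 1))) (v : Fin (N + 1) → k) (d : ℕ) (F : MvPowerSeries (Fin (N + 1)) k) :
    CobordantChart.initEval (fun _ : Fin (N + 1) => 1) v d (subst (fun i => (X (π i) : MvPowerSeries (Fin (N + 1)) k)) F) =
      CobordantChart.initEval (fun _ : Fin (N + 1) => 1) (fun i => v (π i)) d F := by
  have hlin : (fun i => (X (π i) : MvPowerSeries (Fin (N + 1)) k)) = FormalCoordChange.linSubst (π.permMatrix k) :=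
    funext fun i => (linSubst_permMatrix_apply π i).symm
  rw [hlin, AxisNormalize.initEval_subst_linSubst 0]
  congr 1
  funext i
  exact permMatrix_mulVec_apply π v i

/-- A permutation of the letters is a count move for the point centre. -/
theorem isCountMove_X_perm (π : Equiv.Perm (Fin (m + 1))) :
    IsCountMove (fun i => (X (π i) : MvPowerSeries (Fin (m + 1)) k)) (fun _ => 1) :=
  ⟨fun _ => constantCoeff_X _, NCTransport.isUnit_det_linMat_perm π, fun _ => le_rfl, ⟨0, Nat.one_pos⟩⟩

/-- A permutation of the letters STRAIGHTENS EVERY LETTER, so the point move with it is B-permissible for every decoration. -/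
theorem isBPermissible_point_X_perm (δ : Decoration k m) (π : Equiv.Perm (Fin (m + 1))) :
    IsBPermissible δ (fun i => (X (π i) : MvPowerSeries (Fin (m + 1)) k)) (fun _ => 1) :=
  isBPermissible_point (isCountMove_X_perm π) fun l _ => ⟨π l, 1, by rw [map_one]; exact one_ne_zero, by rw [one_mul]⟩

/-! ## Cone division by a letter -/

/-- **CONE DIVISION.**  Over an infinite field: if `in_{o+1}(f · x_l)(v) = λ · v_l^{o+1}` for every `v`, then `in_o(f)(v) = λ · v_l^o` for every
`v` — the degree forms are polynomials, `in_{o+1}(f · x_l) = in_o(f) · x_l` (`initForm_mul_X`), and `x_l` cancels. -/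
theorem initEval_eq_of_initEval_mul_X [Infinite k] {N : ℕ} (f : MvPowerSeries (Fin N) k) (l : Fin N) (o : ℕ) (la : k)
    (h : ∀ v : Fin N → k, CobordantChart.initEval (fun _ : Fin N => 1) v (o + 1) (f * X l) = la * v l ^ (o + 1)) :
    ∀ v : Fin N → k, CobordantChart.initEval (fun _ : Fin N => 1) v o f = la * v l ^ o := by
  classical
  set P : MvPolynomial (Fin N) k := ∑ e ∈ (Finset.univ : Finset (Fin N)).finsuppAntidiag o, MvPolynomial.monomial e (coeff e f) with hP
  set Q : MvPolynomial (Fin N) k := ∑ e ∈ (Finset.univ : Finset (Fin N)).finsuppAntidiag (o + 1), MvPolynomial.monomial e (coeff e (f * X l))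
    with hQ
  have hQP : Q = P * MvPolynomial.X l := TOT2Near.initForm_mul_X f l o
  have hQeq : Q = MvPolynomial.C la * MvPolynomial.X l ^ (o + 1) := by
    refine MvPolynomial.funext fun v => ?_
    rw [hQ, ApexFreeOrderDrop.eval_initForm, h v, map_mul, MvPolynomial.eval_C, map_pow, MvPolynomial.eval_X]
  have hPeq : P = MvPolynomial.C la * MvPolynomial.X l ^ o := by
    have h1 : P * MvPolynomial.X l = (MvPolynomial.C la * MvPolynomial.X l ^ o) * MvPolynomial.X l := by
      rw [← hQP, hQeq, pow_succ, mul_assoc]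
    exact mul_right_cancel₀ (MvPolynomial.X_ne_zero l) h1
  intro v
  rw [← ApexFreeOrderDrop.eval_initForm, ← hP, hPeq, map_mul, MvPolynomial.eval_C, map_pow, MvPolynomial.eval_X]

/-! ## The monic form after a swap of letters -/

/-- **THE MONIC FORM OF A GERM WHOSE TANGENT CONE IS A POWER OF A LETTER, BY A SWAP** (`k` infinite).  If `ord f ≥ d` and `in_d f(v) = λ · v_l^d`
(`λ ≠ 0`), then with the swap `x_l ↔ y` (`y = X (Fin.last m)`): `f ∘ swap = H · (y^d + Σ_{j<d} A_j(u) y^j)`, `H(0) ≠ 0`, `ord A_j > d − j`. -/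
theorem exists_monicForm_subst_swap_of_cone [Infinite k] (f : MvPowerSeries (Fin (m + 1)) k) (d : ℕ) (hfo : (d : ℕ∞) ≤ f.order)
    (l : Fin (m + 1)) {la : k} (hla : la ≠ 0)
    (hcone : ∀ v : Fin (m + 1) → k, CobordantChart.initEval (fun _ : Fin (m + 1) => 1) v d f = la * v l ^ d) :
    ∃ (H : MvPowerSeries (Fin (m + 1)) k) (A : Fin d → MvPowerSeries (Fin m) k),
      constantCoeff H ≠ 0 ∧ (∀ j : Fin d, ((d - (j : ℕ) : ℕ) : ℕ∞) < (A j).order) ∧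
      subst (fun i => (X (Equiv.swap l (Fin.last m) i) : MvPowerSeries (Fin (m + 1)) k)) f =
        H * (X (Fin.last m) ^ d + ∑ j : Fin d, rename (Fin.succAboveEmb (Fin.last m)) (A j) * X (Fin.last m) ^ (j : ℕ)) := by
  classical
  set σ := Equiv.swap l (Fin.last m) with hσ
  set F := subst (fun i => (X (σ i) : MvPowerSeries (Fin (m + 1)) k)) f with hF
  have hFo : (d : ℕ∞) ≤ F.order := ConeDichotomy.le_order_subst_of_le _ (fun i => constantCoeff_X _) f _ hfo
  have hFin : ∀ v : Fin (m + 1) → k, CobordantChart.initEval (fun _ : Fin (m + 1) => 1) v d F = la * v (Fin.last m) ^ d := by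
    intro v
    rw [hF, initEval_subst_X_perm, hcone, hσ, Equiv.swap_apply_left]
  have hPF : ∀ E : Fin (m + 1) →₀ ℕ, E (Fin.last m) < d → E.degree ≤ d → coeff E F = 0 := by
    intro E hElast hEdeg
    rcases hEdeg.lt_or_eq with hlt | heq
    · exact coeff_of_lt_order (lt_of_lt_of_le (by exact_mod_cast hlt) hFo)
    · rw [UnaryConeForm.coeff_of_initEval_eq F d la hFin heq, if_neg]
      intro hE
      rw [hE, Finsupp.single_eq_same] at hElast
      exact lt_irrefl d hElast
  have htop : coeff (Finsupp.single (Fin.last m) d) F ≠ 0 := by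
    rw [UnaryConeForm.coeff_of_initEval_eq F d la hFin (Finsupp.degree_single _ _), if_pos rfl]; exact hla
  obtain ⟨H, A, hH, hA, hFeq⟩ := WeierstrassForm.exists_monic_of_polyhedronCond F hPF htop
  exact ⟨H, A, hH, hA, hFeq⟩

/-! ## Multiplying a monic form by `y`: the label `(0, A_0, …, A_{d−1})` -/

/-- `(y^d + Σ_{j<d} A_j y^j) · y = y^{d+1} + Σ_{j<d+1} A′_j y^j` with `A′ = (0, A_0, …, A_{d−1})`. -/
theorem monicForm_mul_X_last {d : ℕ} (A : Fin d → MvPowerSeries (Fin m) k) :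
    (X (Fin.last m) ^ d + ∑ j : Fin d, rename (Fin.succAboveEmb (Fin.last m)) (A j) * X (Fin.last m) ^ (j : ℕ)) * X (Fin.last m) =
      X (Fin.last m) ^ (d + 1) +
        ∑ j : Fin (d + 1), rename (Fin.succAboveEmb (Fin.last m)) (Matrix.vecCons 0 A j) * X (Fin.last m) ^ (j : ℕ) := by
  rw [Fin.sum_univ_succ, Matrix.cons_val_zero, map_zero, zero_mul, zero_add, add_mul, pow_succ, Finset.sum_mul]
  congr 1
  refine Finset.sum_congr rfl fun j _ => ?_
  rw [Matrix.cons_val_succ, Fin.val_succ, pow_succ, mul_assoc]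

/-- The label `(0, A_0, …, A_{d−1})` is a position of degree `d + 1` when `A` is one of degree `d`. -/
theorem isPos_vecCons_zero {d : ℕ} {A : Fin d → MvPowerSeries (Fin m) k} (hA : ∀ j : Fin d, ((d - (j : ℕ) : ℕ) : ℕ∞) < (A j).order) :
    ∀ j : Fin (d + 1), ((d + 1 - (j : ℕ) : ℕ) : ℕ∞) < (Matrix.vecCons 0 A j).order := by
  intro j
  refine Fin.cases ?_ (fun i => ?_) j
  · rw [Matrix.cons_val_zero, order_zero]; exact WithTop.coe_lt_top _
  · rw [Matrix.cons_val_succ, Fin.val_succ, show d + 1 - (i + 1) = d - i by omega]; exact hA i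

/-! ## The decorated entry with an old letter -/

/-- With `O = {l}`: `∏_{l' ∈ O} x_{l'} = x_l` and `c = o + 1`. -/
theorem Decoration.prod_O_eq_of_eq_singleton {δ : Decoration k m} {l : Fin (m + 1)} (hO : δ.O = {l}) :
    (∏ l' ∈ δ.O, (X l' : MvPowerSeries (Fin (m + 1)) k)) = X l ∧ δ.c = δ.o + 1 := by
  rw [Decoration.c, hO, Finset.prod_singleton, Finset.card_singleton]
  exact ⟨rfl, rfl⟩

/-- **THE DECORATED ENTRY WITH AN OLD LETTER** (`k` infinite).  If `O = {l}` and the degree-`(o+1)` form of `f̃ = f · x_l` is `λ · x_l^{o+1}`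
(`λ ≠ 0`: regime `e = 2` whose maximal-contact plane is the old component), then after the SWAP `x_l ↔ y` — a legal move straightening every letter
(`isBPermissible_point_X_perm`) — `f̃ ∘ swap = H · (y^{o+1} + Σ_{j ≤ o} A_j y^j)` with `H(0) ≠ 0`, `A` a position and **`A_0 = 0`**. -/
theorem exists_presentation_swap_of_oldLetter_cone [Infinite k] {δ : Decoration k m} (hf : δ.f ≠ 0) {l : Fin (m + 1)} (hO : δ.O = {l})
    {la : k} (hla : la ≠ 0)
    (hcone : ∀ v : Fin (m + 1) → k,
      CobordantChart.initEval (fun _ : Fin (m + 1) => 1) v δ.c (δ.f * ∏ l' ∈ δ.O, X l') = la * v l ^ δ.c) :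
    ∃ (H : MvPowerSeries (Fin (m + 1)) k) (A : Fin (δ.o + 1) → MvPowerSeries (Fin m) k),
      constantCoeff H ≠ 0 ∧ (∀ j : Fin (δ.o + 1), ((δ.o + 1 - (j : ℕ) : ℕ) : ℕ∞) < (A j).order) ∧ A 0 = 0 ∧
      subst (fun i => (X (Equiv.swap l (Fin.last m) i) : MvPowerSeries (Fin (m + 1)) k)) (δ.f * ∏ l' ∈ δ.O, X l') =
        H * (X (Fin.last m) ^ (δ.o + 1) +
          ∑ j : Fin (δ.o + 1), rename (Fin.succAboveEmb (Fin.last m)) (A j) * X (Fin.last m) ^ (j : ℕ)) := by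
  obtain ⟨hprod, hc⟩ := Decoration.prod_O_eq_of_eq_singleton hO
  rw [hprod, hc] at hcone
  rw [hprod]
  have hfo : ((δ.o : ℕ) : ℕ∞) ≤ δ.f.order := by
    rw [Decoration.o, ENat.coe_toNat (by rw [ne_eq, order_eq_top_iff]; exact hf)]
  have hcone' := initEval_eq_of_initEval_mul_X δ.f l δ.o la hcone
  obtain ⟨H, A, hH, hA, hFeq⟩ := exists_monicForm_subst_swap_of_cone δ.f δ.o hfo l hla hcone'
  have hs : HasSubst (fun i => (X (Equiv.swap l (Fin.last m) i) : MvPowerSeries (Fin (m + 1)) k)) :=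
    hasSubst_of_constantCoeff_zero fun i => constantCoeff_X _
  refine ⟨H, Matrix.vecCons 0 A, hH, isPos_vecCons_zero hA, Matrix.cons_val_zero _ _, ?_⟩
  rw [← coe_substAlgHom hs, map_mul, coe_substAlgHom, hFeq, subst_X hs, Equiv.swap_apply_left, mul_assoc, monicForm_mul_X_last]

/-! ## From a linear-form cone to the letter cone (the e = 2 detection data of `WildPurePower.cone_eq_of_wide`) -/

/-- **A LINEAR-FORM CONE OF `f · x_l` IS ALONG `x_l`.**  If `in_{o+1}(f · x_l)(v) = λ · (ℓ · v)^{o+1}` for every `v` with `λ ≠ 0`, then `ℓ_i = 0` for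
`i ≠ l` (test `v = e_i`: the left side carries the factor `v_l = 0`). -/
theorem apply_eq_zero_of_cone_mul_X {N : ℕ} (f : MvPowerSeries (Fin N) k) (l : Fin N) (o : ℕ) {la : k} (hla : la ≠ 0) (ℓ : Fin N → k)
    (h : ∀ v : Fin N → k, CobordantChart.initEval (fun _ : Fin N => 1) v (o + 1) (f * X l) = la * dotProduct ℓ v ^ (o + 1))
    {i : Fin N} (hi : i ≠ l) : ℓ i = 0 := by
  classical
  have hv := h (Pi.single i 1)
  rw [TOT2Near.initEval_mul_X, Pi.single_eq_of_ne (Ne.symm hi), mul_zero, dotProduct_comm, single_dotProduct, one_mul] at hv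
  exact pow_eq_zero_iff (n := o + 1) (by omega) |>.mp ((mul_eq_zero.mp hv.symm).resolve_left hla)

/-- Hence the cone is the LETTER cone: `in_{o+1}(f · x_l)(v) = (λ · ℓ_l^{o+1}) · v_l^{o+1}` with `λ · ℓ_l^{o+1} ≠ 0` (`ℓ ≠ 0`). -/
theorem letterCone_of_cone_mul_X {N : ℕ} (f : MvPowerSeries (Fin N) k) (l : Fin N) (o : ℕ) {la : k} (hla : la ≠ 0) {ℓ : Fin N → k}
    (hℓ : ℓ ≠ 0)
    (h : ∀ v : Fin N → k, CobordantChart.initEval (fun _ : Fin N => 1) v (o + 1) (f * X l) = la * dotProduct ℓ v ^ (o + 1)) :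
    la * ℓ l ^ (o + 1) ≠ 0 ∧
      ∀ v : Fin N → k, CobordantChart.initEval (fun _ : Fin N => 1) v (o + 1) (f * X l) = la * ℓ l ^ (o + 1) * v l ^ (o + 1) := by
  classical
  have hzero : ∀ i, i ≠ l → ℓ i = 0 := fun i hi => apply_eq_zero_of_cone_mul_X f l o hla ℓ h hi
  have hℓl : ℓ l ≠ 0 := by
    intro h0
    apply hℓ
    funext i
    by_cases hi : i = l
    · rw [hi, h0]; rfl
    · exact hzero i hi
  have hdot : ∀ v : Fin N → k, dotProduct ℓ v = ℓ l * v l := fun v => by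
    rw [dotProduct, Finset.sum_eq_single l (fun i _ hi => by rw [hzero i hi, zero_mul]) (fun h => absurd (Finset.mem_univ _) h)]
  refine ⟨mul_ne_zero hla (pow_ne_zero _ hℓl), fun v => ?_⟩
  rw [h v, hdot, mul_pow, mul_assoc]

/-- **A LINEAR-FORM CONE OF `f · ∏_{l∈O} x_l` IS ALONG EVERY OLD LETTER**: if `in_{o+|O|}(f · ∏_O x)(v) = λ · (ℓ · v)^{o+|O|}` with `λ ≠ 0` and
`l ∈ O`, then `ℓ_i = 0` for every `i ≠ l` (`TOT2Near.initEval_mul_prod_X`: the left side carries the factor `v_l`). -/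
theorem apply_eq_zero_of_cone_mul_prod_X {N : ℕ} (f : MvPowerSeries (Fin N) k) (O : Finset (Fin N)) (o : ℕ) {la : k} (hla : la ≠ 0)
    (ℓ : Fin N → k)
    (h : ∀ v : Fin N → k, CobordantChart.initEval (fun _ : Fin N => 1) v (o + O.card) (f * ∏ l ∈ O, X l) =
      la * dotProduct ℓ v ^ (o + O.card))
    {l : Fin N} (hl : l ∈ O) {i : Fin N} (hi : i ≠ l) : ℓ i = 0 := by
  classical
  have hv := h (Pi.single i 1)
  rw [TOT2Near.initEval_mul_prod_X, Finset.prod_eq_zero hl (Pi.single_eq_of_ne (Ne.symm hi) _), mul_zero, dotProduct_comm,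
    single_dotProduct, one_mul] at hv
  have hpos : o + O.card ≠ 0 := by have := Finset.card_pos.mpr ⟨l, hl⟩; omega
  exact pow_eq_zero_iff hpos |>.mp ((mul_eq_zero.mp hv.symm).resolve_left hla)

/-- **HENCE AT MOST ONE OLD LETTER IN THE REGIME `e = 2`**: a non-zero linear-form cone of `f · ∏_{l∈O} x_l` forces `|O| ≤ 1`. -/
theorem card_le_one_of_cone_mul_prod_X {N : ℕ} (f : MvPowerSeries (Fin N) k) (O : Finset (Fin N)) (o : ℕ) {la : k} (hla : la ≠ 0)
    {ℓ : Fin N → k} (hℓ : ℓ ≠ 0)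
    (h : ∀ v : Fin N → k, CobordantChart.initEval (fun _ : Fin N => 1) v (o + O.card) (f * ∏ l ∈ O, X l) =
      la * dotProduct ℓ v ^ (o + O.card)) :
    O.card ≤ 1 := by
  rw [Finset.card_le_one]
  intro l₁ h₁ l₂ h₂
  by_contra hne
  apply hℓ
  funext i
  by_cases hi : i = l₁
  · rw [hi]; exact apply_eq_zero_of_cone_mul_prod_X f O o hla ℓ h h₂ hne
  · exact apply_eq_zero_of_cone_mul_prod_X f O o hla ℓ h h₁ hi

/-- **THE DISPATCH AT THE ENTRY OF THE REGIME `e = 2`**: a decorated state whose `f̃ = f · ∏_{l∈O} x_l` has a non-zero linear-form cone in degree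
`c = o + |O|` has NO old letter (`O = ∅`: the linear entry `NCPoly.germIsNC_or_dWinsTo_exit_of_two_inv` / `WeierstrassForm.exists_monicForm`) or
EXACTLY ONE (`O = {l}`: the swap entry `exists_presentation_swap_of_oldLetter_linearCone` below). -/
theorem Decoration.O_eq_empty_or_singleton_of_linearCone {δ : Decoration k m} {la : k} (hla : la ≠ 0) {ℓ : Fin (m + 1) → k} (hℓ : ℓ ≠ 0)
    (hcone : ∀ v : Fin (m + 1) → k,
      CobordantChart.initEval (fun _ : Fin (m + 1) => 1) v δ.c (δ.f * ∏ l' ∈ δ.O, X l') = la * dotProduct ℓ v ^ δ.c) :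
    δ.O = ∅ ∨ ∃ l, δ.O = {l} := by
  have hcard : δ.O.card ≤ 1 := card_le_one_of_cone_mul_prod_X δ.f δ.O δ.o hla hℓ hcone
  rcases Nat.le_one_iff_eq_zero_or_eq_one.mp hcard with h0 | h1
  · exact Or.inl (Finset.card_eq_zero.mp h0)
  · obtain ⟨l, hl⟩ := Finset.card_eq_one.mp h1
    exact Or.inr ⟨l, hl⟩

/-- **THE DECORATED ENTRY FROM THE `e = 2` DETECTION DATA**: `O = {l}` and `in_c(f · ∏_{O} x) = λ · (ℓ · v)^c` (`λ ≠ 0`, `ℓ ≠ 0` — the output of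
`WildPurePower.cone_eq_of_wide` / `NCPoly.la_ne_zero_of_cone` on two independent invariance vectors) ⇒ the swap presentation with `A_0 = 0`. -/
theorem exists_presentation_swap_of_oldLetter_linearCone [Infinite k] {δ : Decoration k m} (hf : δ.f ≠ 0) {l : Fin (m + 1)}
    (hO : δ.O = {l}) {la : k} (hla : la ≠ 0) {ℓ : Fin (m + 1) → k} (hℓ : ℓ ≠ 0)
    (hcone : ∀ v : Fin (m + 1) → k,
      CobordantChart.initEval (fun _ : Fin (m + 1) => 1) v δ.c (δ.f * ∏ l' ∈ δ.O, X l') = la * dotProduct ℓ v ^ δ.c) :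
    ∃ (H : MvPowerSeries (Fin (m + 1)) k) (A : Fin (δ.o + 1) → MvPowerSeries (Fin m) k),
      constantCoeff H ≠ 0 ∧ (∀ j : Fin (δ.o + 1), ((δ.o + 1 - (j : ℕ) : ℕ) : ℕ∞) < (A j).order) ∧ A 0 = 0 ∧
      subst (fun i => (X (Equiv.swap l (Fin.last m) i) : MvPowerSeries (Fin (m + 1)) k)) (δ.f * ∏ l' ∈ δ.O, X l') =
        H * (X (Fin.last m) ^ (δ.o + 1) +
          ∑ j : Fin (δ.o + 1), rename (Fin.succAboveEmb (Fin.last m)) (A j) * X (Fin.last m) ^ (j : ℕ)) := by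
  obtain ⟨hprod, hc⟩ := Decoration.prod_O_eq_of_eq_singleton hO
  have hcone' : ∀ v : Fin (m + 1) → k,
      CobordantChart.initEval (fun _ : Fin (m + 1) => 1) v (δ.o + 1) (δ.f * X l) = la * dotProduct ℓ v ^ (δ.o + 1) := by
    intro v; have h := hcone v; rwa [hprod, hc] at h
  obtain ⟨hla', hletter⟩ := letterCone_of_cone_mul_X δ.f l δ.o hla hℓ hcone'
  refine exists_presentation_swap_of_oldLetter_cone hf hO hla' fun v => ?_
  rw [hprod, hc]
  exact hletter v

end TameFourTupleDrop

end Summit.ResolutionOfSingularities.ResolutionOfSingularities.Theorems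

end
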